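import Mathlib.GroupTheory.SpecificGroups.Dihedral
import Mathlib.GroupTheory.SpecificGroups.Quaternion
import Mathlib.Tactic.Ring
import Literature.Combinatorics.Additive.TripleProductProperty
import Summits.MatrixMultiplication.OmegaCensus.DihedralTPPFamilyAllN
import Summits.MatrixMultiplication.OmegaCensus.DihedralLikeLaw
import HarnessLib

/-!
# Lifting TPP triples through a homomorphism; the dicyclic law `β(Q_{4n}) = 8⌊2n/3⌋` for `n ≢ 1 (mod 3)`

ω-census, family (b3).  Framing: lottery ticket; floor = certified bounds/negative ranges.

* `tpp_lift`: if `π : G →* H`, `(S,T,U)` is a TPP triple of `H`, and `S̃, T̃, Ũ ⊆ G` map into `S, T, U` with `π`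
  injective on `T̃` and on `Ũ`, then `(S̃, T̃, Ũ)` is a TPP triple of `G` (so `S̃` may be a full preimage: the
  classical `β(G) ≥ β(G/K)·β(K)` mechanism of Cohn–Umans / Hedtke–Murthy in the special case used here).
* `quaternion_tpp_volume_ge`: via `π : Q_{4n} → D_{2n}` (`a i ↦ r i`, `xa i ↦ sr i`, kernel `{1, a^n}`) every TPP triple of
  `D_{2n}` lifts to one of `Q_{4n}` of twice the volume; with the dihedral family (`dihedral_volume_ge_law`) this gives
  `β(Q_{4n}) ≥ 8⌊2n/3⌋` for all `n ≥ 3`.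
* `dicyclic_law`: for `n ≥ 3`, `n ≢ 1 (mod 3)`: `β(Q_{4n}) = 8⌊2n/3⌋ = 4⌊|Q_{4n}|/3⌋` exactly (upper half
  `tpp_volume_le_law_quaternion`).  For `n ≡ 1 (mod 3)` the kernel window is `[8⌊2n/3⌋, 8⌊2n/3⌋ + 4]`; the census's SAT
  data (`Q₁₆, Q₂₈, Q₄₀`) say the lower end is the truth there (conjecture `β(Q_{4n}) = 8⌊2n/3⌋ = 2β(D_{2n})` for all `n`).
-/

namespace Summit.MatrixMultiplication.OmegaCensus

open Literature.Combinatorics.Additive Finset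

/-- **Lifting a TPP triple through a homomorphism.** [folklore] -/
theorem tpp_lift {G H : Type*} [Group G] [Group H] (π : G →* H) {S T U : Finset H} {S' T' U' : Finset G}
    (h : TripleProductProperty S T U) (hS : ∀ x ∈ S', π x ∈ S) (hT : ∀ x ∈ T', π x ∈ T) (hU : ∀ x ∈ U', π x ∈ U)
    (hTinj : Set.InjOn π ↑T') (hUinj : Set.InjOn π ↑U') : TripleProductProperty S' T' U' := by
  intro s hs s' hs' t ht t' ht' u hu u' hu' heq
  have himg : π s * (π s')⁻¹ * (π t * (π t')⁻¹) * (π u * (π u')⁻¹) = 1 := by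
    have := congrArg π heq
    simpa only [map_mul, map_inv, map_one] using this
  obtain ⟨-, ht2, hu2⟩ := h _ (hS s hs) _ (hS s' hs') _ (hT t ht) _ (hT t' ht') _ (hU u hu) _ (hU u' hu') himg
  have htt : t = t' := hTinj (mem_coe.2 ht) (mem_coe.2 ht') ht2
  have huu : u = u' := hUinj (mem_coe.2 hu) (mem_coe.2 hu') hu2
  subst htt huu
  rw [mul_inv_cancel, mul_inv_cancel, mul_one, mul_one, mul_inv_eq_one] at heq
  exact ⟨heq, rfl, rfl⟩

variable {n : ℕ} [NeZero n]

omit [NeZero n] in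
/-- The projection `Q_{4n} → D_{2n}`, `a i ↦ r i`, `xa i ↦ sr i` (indices reduced from `ZMod 2n` to `ZMod n`), is
multiplicative. [folklore] -/
theorem quaternion_to_dihedral_mul (x y : QuaternionGroup n) :
    (QuaternionGroup.recOn (motive := fun _ => DihedralGroup n) (x * y)
        (fun i => DihedralGroup.r (ZMod.castHom (dvd_mul_left n 2) (ZMod n) i))
        (fun i => DihedralGroup.sr (ZMod.castHom (dvd_mul_left n 2) (ZMod n) i))) =
      QuaternionGroup.recOn (motive := fun _ => DihedralGroup n) x
          (fun i => DihedralGroup.r (ZMod.castHom (dvd_mul_left n 2) (ZMod n) i))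
          (fun i => DihedralGroup.sr (ZMod.castHom (dvd_mul_left n 2) (ZMod n) i)) *
        QuaternionGroup.recOn (motive := fun _ => DihedralGroup n) y
          (fun i => DihedralGroup.r (ZMod.castHom (dvd_mul_left n 2) (ZMod n) i))
          (fun i => DihedralGroup.sr (ZMod.castHom (dvd_mul_left n 2) (ZMod n) i)) := by
  cases x with
  | a i =>
    cases y with
    | a j => simp [QuaternionGroup.a_mul_a, DihedralGroup.r_mul_r]
    | xa j => simp [QuaternionGroup.a_mul_xa, DihedralGroup.r_mul_sr]
  | xa i =>
    cases y with
    | a j => simp [QuaternionGroup.xa_mul_a, DihedralGroup.sr_mul_r]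
    | xa j => simp [QuaternionGroup.xa_mul_xa, DihedralGroup.sr_mul_sr]

/-- **Every TPP triple of `D_{2n}` lifts to `Q_{4n}` with twice the volume.** [folklore] -/
theorem quaternion_tpp_volume_ge {S T U : Finset (DihedralGroup n)} (h : TripleProductProperty S T U) :
    ∃ S' T' U' : Finset (QuaternionGroup n), TripleProductProperty S' T' U' ∧
      S'.card * T'.card * U'.card = 2 * (S.card * T.card * U.card) := by
  -- the projection as a monoid hom
  let f : QuaternionGroup n → DihedralGroup n := fun x =>
    QuaternionGroup.recOn (motive := fun _ => DihedralGroup n) x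
      (fun i => DihedralGroup.r (ZMod.castHom (dvd_mul_left n 2) (ZMod n) i))
      (fun i => DihedralGroup.sr (ZMod.castHom (dvd_mul_left n 2) (ZMod n) i))
  have hf : ∀ x y, f (x * y) = f x * f y := quaternion_to_dihedral_mul
  let π : QuaternionGroup n →* DihedralGroup n := MonoidHom.mk' f hf
  have hπa : ∀ i, π (QuaternionGroup.a i) = DihedralGroup.r (ZMod.castHom (dvd_mul_left n 2) (ZMod n) i) :=
    fun i => rfl
  have hπxa : ∀ i, π (QuaternionGroup.xa i) = DihedralGroup.sr (ZMod.castHom (dvd_mul_left n 2) (ZMod n) i) :=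
    fun i => rfl
  -- a section σ: lift the index through `ZMod.val`
  let σ : DihedralGroup n → QuaternionGroup n := fun g =>
    DihedralGroup.recOn (motive := fun _ => QuaternionGroup n) g
      (fun j => QuaternionGroup.a (j.val : ZMod (2 * n))) (fun j => QuaternionGroup.xa (j.val : ZMod (2 * n)))
  have hcast : ∀ j : ZMod n, (ZMod.castHom (dvd_mul_left n 2) (ZMod n)) ((j.val : ℕ) : ZMod (2 * n)) = j := by
    intro j; rw [map_natCast, ZMod.natCast_zmod_val]
  have hπσ : ∀ g, π (σ g) = g := by
    intro g
    cases g with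
    | r j => show DihedralGroup.r _ = _; rw [hcast]
    | sr j => show DihedralGroup.sr _ = _; rw [hcast]
  have hσinj : Function.Injective σ := fun g g' hgg' => by rw [← hπσ g, ← hπσ g', hgg']
  -- the central element `z = a^n` of the kernel
  set z : QuaternionGroup n := QuaternionGroup.a (n : ZMod (2 * n)) with hz
  have hπz : π z = 1 := by
    rw [hz, hπa, map_natCast, ZMod.natCast_self, DihedralGroup.one_def]
  have hz1 : z ≠ 1 := by
    rw [hz, QuaternionGroup.one_def]
    intro heq
    have h' : ((n : ℕ) : ZMod (2 * n)) = ((0 : ℕ) : ZMod (2 * n)) := by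
      have := QuaternionGroup.a.inj heq; exact_mod_cast this
    rw [ZMod.natCast_eq_natCast_iff'] at h'
    have hn0 := NeZero.ne n
    rw [Nat.mod_eq_of_lt (by omega), Nat.zero_mod] at h'
    exact hn0 h'
  -- the lifted triple
  refine ⟨S.image σ ∪ S.image (fun s => σ s * z), T.image σ, U.image σ, ?_, ?_⟩
  · refine tpp_lift π h ?_ ?_ ?_ ?_ ?_
    · intro x hx
      rcases mem_union.1 hx with hx | hx
      · obtain ⟨s, hs, rfl⟩ := mem_image.1 hx; rw [hπσ]; exact hs
      · obtain ⟨s, hs, rfl⟩ := mem_image.1 hx; rw [map_mul, hπσ, hπz, mul_one]; exact hs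
    · intro x hx; obtain ⟨t, ht, rfl⟩ := mem_image.1 hx; rw [hπσ]; exact ht
    · intro x hx; obtain ⟨u, hu, rfl⟩ := mem_image.1 hx; rw [hπσ]; exact hu
    · rintro x hx y hy hxy
      obtain ⟨t, -, rfl⟩ := mem_image.1 (mem_coe.1 hx)
      obtain ⟨t', -, rfl⟩ := mem_image.1 (mem_coe.1 hy)
      rw [hπσ, hπσ] at hxy; rw [hxy]
    · rintro x hx y hy hxy
      obtain ⟨u, -, rfl⟩ := mem_image.1 (mem_coe.1 hx)
      obtain ⟨u', -, rfl⟩ := mem_image.1 (mem_coe.1 hy)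
      rw [hπσ, hπσ] at hxy; rw [hxy]
  · have hdisj : Disjoint (S.image σ) (S.image fun s => σ s * z) := by
      rw [disjoint_left]
      intro x hx hx'
      obtain ⟨s, -, rfl⟩ := mem_image.1 hx
      obtain ⟨s', -, hs'⟩ := mem_image.1 hx'
      have : π (σ s' * z) = π (σ s) := by rw [hs']
      rw [map_mul, hπσ, hπσ, hπz, mul_one] at this
      subst this
      exact hz1 (mul_eq_left.mp hs')
    have hinj2 : Function.Injective fun s => σ s * z := fun s s' hss' => hσinj (mul_right_cancel hss')
    rw [card_union_of_disjoint hdisj, card_image_of_injective _ hσinj, card_image_of_injective _ hinj2,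
      card_image_of_injective _ hσinj, card_image_of_injective _ hσinj]
    ring

/-- `β(Q_{4n}) ≥ 8⌊2n/3⌋` for every `n ≥ 3` (lift of the dihedral family). [folklore] -/
theorem quaternion_volume_ge_law (hn : 3 ≤ n) :
    ∃ S T U : Finset (QuaternionGroup n), TripleProductProperty S T U ∧ S.card * T.card * U.card = 8 * (2 * n / 3) := by
  obtain ⟨S, T, U, h, -, -, -, hvol⟩ := dihedral_volume_ge_law n hn
  obtain ⟨S', T', U', h', hvol'⟩ := quaternion_tpp_volume_ge h
  exact ⟨S', T', U', h', by rw [hvol', hvol]; ring⟩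

/-- **The dicyclic law for `n ≢ 1 (mod 3)`, `n ≥ 3`: `β(Q_{4n}) = 8⌊2n/3⌋`** (both halves kernel). For `n ≡ 1 (mod 3)`
the kernel gives `8⌊2n/3⌋ ≤ β(Q_{4n}) ≤ 8⌊2n/3⌋ + 4`. [folklore] -/
theorem dicyclic_law (hn : 3 ≤ n) (hmod : n % 3 ≠ 1) :
    (∀ S T U : Finset (QuaternionGroup n), TripleProductProperty S T U → S.card * T.card * U.card ≤ 8 * (2 * n / 3)) ∧
    ∃ S T U : Finset (QuaternionGroup n), TripleProductProperty S T U ∧ S.card * T.card * U.card = 8 * (2 * n / 3) := by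
  refine ⟨fun S T U h => ?_, quaternion_volume_ge_law hn⟩
  have := tpp_volume_le_law_quaternion h
  omega

/-- The `n ≡ 1 (mod 3)` window: `8⌊2n/3⌋ ≤ β(Q_{4n}) ≤ 8⌊2n/3⌋ + 4`. [folklore] -/
theorem dicyclic_window (hn : 3 ≤ n) :
    (∀ S T U : Finset (QuaternionGroup n), TripleProductProperty S T U →
        S.card * T.card * U.card ≤ 8 * (2 * n / 3) + 4) ∧
    ∃ S T U : Finset (QuaternionGroup n), TripleProductProperty S T U ∧ S.card * T.card * U.card = 8 * (2 * n / 3) := by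
  refine ⟨fun S T U h => ?_, quaternion_volume_ge_law hn⟩
  have := tpp_volume_le_law_quaternion h
  omega

end Summit.MatrixMultiplication.OmegaCensus
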